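import Literature.NumberTheory.CubicFields.UniformityPerDiscQuadratic
import Literature.NumberTheory.CubicFields.UniformityPerDiscCyclic
import Literature.NumberTheory.CubicFields.UniformityFieldReduction
import Literature.NumberTheory.CubicFields.ThreeTorsionMeanDecomposition
import HarnessLib

/-!
# The per-discriminant bound `#{K : d_K = D₀f²} ≪ 3^{ω(f)} #Cl₃(D₀)` and the uniformity estimate

`Proofs` file (theorems only), topic `Literature/NumberTheory/CubicFields`, assembling the
class-field-theoretic input (B) of `UniformityFieldReduction.btt_uniformity_sqDvd_of_mean_of_perDisc`:

* `cubicFieldCountOfDisc_le_threeTorsion` — **(B)**: for every fundamental discriminant `D₀` (or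
  `D₀ = 1`) and `f ≥ 1`, `#{cubic fields of discriminant D₀ f²}/≅ ≤ 3^{81} · 3^{ω(f)} · #Cl₃(D₀)`
  (`UniformityPerDiscQuadratic.cubicFieldCountOfDisc_mul_sq_le` over the quadratic field of
  discriminant `D₀`, `UniformityPerDiscCyclic.cubicFieldCountOfDisc_sq_le` for `D₀ = 1`;
  Davenport–Heilbronn 1971 Prop. 1, Belabas–Bhargava–Pomerance 2010 Lemma 3.3,
  Bhargava–Shankar–Tsimerman 2013 §8.2);
* `btt_uniformity_sqDvd_of_davenport_of_dictionary` — the uniformity estimate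
  `btt_uniformity_sqDvd` (BTT 2023 Prop. 4.5 / 21) from (B), Hasse's dictionary
  `#Cl₃(D) = 2·#{cubic fields of disc D} + 1` (the statement of the tree's named fact
  `threeTorsion_eq_two_mul_cubicFieldCountOfDisc_add_one`) and Davenport's bound `O(X)` for the number of
  `GL₂(ℤ)`-classes of irreducible integral binary cubic forms with `0 < ±Disc < X`.

## References

* M. Bhargava, T. Taniguchi, F. Thorne, *Improved error estimates for the Davenport–Heilbronn
  theorems*, Math. Ann. 389 (2024) = arXiv:2107.12819, Prop. 4.5 [BhargavaTaniguchiThorne2023].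
* K. Belabas, M. Bhargava, C. Pomerance, *Error estimates for the Davenport–Heilbronn theorems*,
  Duke Math. J. 153 (2010), Lemma 3.3 [BelabasBhargavaPomerance2010].
* H. Davenport, H. Heilbronn, *On the density of discriminants of cubic fields. II*, Proc. Roy. Soc.
  A 322 (1971), Prop. 1 [DavenportHeilbronn1971].
-/

noncomputable section

open NumberField Module

namespace Literature.NumberTheory.CubicFields

open Literature.NumberTheory.QuadraticFields BinaryCubic

/-- **(B) The per-discriminant bound.**  There is `M` (namely `3^{81}`) such that for every
fundamental discriminant `D₀`, or `D₀ = 1`, and every `f ≥ 1`,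
`#{cubic fields K : d_K = D₀ f²}/≅ ≤ M · 3^{ω(f)} · #Cl₃(D₀)` — Hasse's injection of cubic fields of
discriminant `D₀ f²` into cubic ring class characters of conductor dividing `3^∞ f` over `ℚ(√D₀)`
and the `3`-rank bound `ω(f) + r₃(D₀) + O(1)` (`cubicFieldCountOfDisc_mul_sq_le`; cyclic cubic fields
for `D₀ = 1`, `cubicFieldCountOfDisc_sq_le`). [cite: DavenportHeilbronn1971, Prop. 1]
[cite: BelabasBhargavaPomerance2010, Lemma 3.3] -/
theorem cubicFieldCountOfDisc_le_threeTorsion :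
    ∃ M : ℝ, ∀ D₀ : ℤ, (((D₀ % 4 = 1 ∧ Squarefree D₀ ∧ D₀ ≠ 1) ∨
      (4 ∣ D₀ ∧ (D₀ / 4 % 4 = 2 ∨ D₀ / 4 % 4 = 3) ∧ Squarefree (D₀ / 4))) ∨ D₀ = 1) → ∀ f : ℕ, 0 < f →
      (cubicFieldCountOfDisc (D₀ * (f : ℤ) ^ 2) : ℝ) ≤ (M * 3 ^ f.primeFactors.card * quadFieldThreeTorsion D₀) := by
  refine ⟨(3 : ℝ) ^ 81, fun D₀ hD₀ f hf => ?_⟩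
  have hf0 : ((f : ℤ)) ≠ 0 := by exact_mod_cast hf.ne'
  have hfabs : ((f : ℤ)).natAbs = f := Int.natAbs_natCast f
  rcases hD₀ with hD₀ | rfl
  · -- `D₀` fundamental: the quadratic field of discriminant `D₀`
    obtain ⟨k, _, _, hk2, hdk⟩ := Quadratic.exists_numberField_discr_eq hD₀
    haveI : Algebra.IsQuadraticExtension ℚ k := ⟨hk2⟩
    have h := cubicFieldCountOfDisc_mul_sq_le (k := k) hk2 hf0
    rw [hdk, natCard_quotient_span_nine k, hk2, hfabs,
      ← quadFieldThreeTorsion_eq D₀ k hk2 hdk] at h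
    have h' : (cubicFieldCountOfDisc (D₀ * (f : ℤ) ^ 2) : ℝ) ≤
        ((3 ^ (9 ^ 2) * 3 ^ f.primeFactors.card * quadFieldThreeTorsion D₀ : ℕ) : ℝ) := by
      exact_mod_cast h
    refine h'.trans (le_of_eq ?_)
    push_cast
    norm_num
  · -- `D₀ = 1`: cyclic cubic fields
    have h := cubicFieldCountOfDisc_sq_le hf0
    rw [hfabs] at h
    have h1 : quadFieldThreeTorsion 1 = 1 :=
      quadFieldThreeTorsion_of_not_isFundamental (by
        rintro (⟨-, -, h⟩ | ⟨h4, -, -⟩)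
        · exact h rfl
        · norm_num at h4)
    rw [one_mul, h1, Nat.cast_one, mul_one]
    have h' : (cubicFieldCountOfDisc ((f : ℤ) ^ 2) : ℝ) ≤ ((3 ^ 9 * 3 ^ f.primeFactors.card : ℕ) : ℝ) := by
      exact_mod_cast h
    refine h'.trans ?_
    push_cast
    have h3 : (0 : ℝ) ≤ 3 ^ f.primeFactors.card := by positivity
    nlinarith [pow_le_pow_right₀ (by norm_num : (1 : ℝ) ≤ 3) (by norm_num : 9 ≤ 81)]

/-- **The uniformity estimate from Davenport's bound and Hasse's dictionary** (Bhargava–Taniguchi–Thorne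
2023, Prop. 4.5 = Prop. 21, after Davenport–Heilbronn 1971 Prop. 1 / BBP 2010 Lemma 3.3 / BST 2013
§8.2): `Σ_{0<±D<X, q²∣D} h(D) ≪ 6^{ω(q)} X/q²`, granted (i) Hasse's dictionary
`#Cl₃(D) = 2·#{cubic fields of disc D} + 1` for fundamental `D` (the statement of the named fact
`threeTorsion_eq_two_mul_cubicFieldCountOfDisc_add_one`) and (ii) Davenport's bound: the number of
`GL₂(ℤ)`-classes of irreducible integral binary cubic forms with `0 < ±Disc < X` is `O(X)`.  The rest —
the subring recursion (non-maximal part), the reduction of the maximal part to cubic fields, the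
per-discriminant class-field-theoretic bound (B) (`cubicFieldCountOfDisc_le_threeTorsion`) and the
summation — is proved in the tree. [cite: BhargavaTaniguchiThorne2023, Prop. 4.5] -/
theorem btt_uniformity_sqDvd_of_davenport_of_dictionary
    (hdict : ∀ D : ℤ, ((D % 4 = 1 ∧ Squarefree D ∧ D ≠ 1) ∨
      (4 ∣ D ∧ (D / 4 % 4 = 2 ∨ D / 4 % 4 = 3) ∧ Squarefree (D / 4))) →
      quadFieldThreeTorsion D = 2 * cubicFieldCountOfDisc D + 1)
    (hcount : ∃ C : ℝ, ∀ s : ℤ, (s = 1 ∨ s = -1) → ∀ X : ℕ,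
      (({O | ∃ f : BinaryCubic ℤ, O = gl2zOrbit f ∧ f.IsIrreducible ∧ 0 < s * f.disc ∧ s * f.disc < X}.ncard : ℕ) : ℝ)
        ≤ C * X) :
    btt_uniformity_sqDvd :=
  btt_uniformity_sqDvd_of_mean_of_perDisc (mean_threeTorsion_of_dictionary_of_orbitCount hdict hcount)
    cubicFieldCountOfDisc_le_threeTorsion

/-- The same with the dictionary supplied by the tree's named fact. [cite: BhargavaTaniguchiThorne2023, Prop. 4.5] -/
theorem btt_uniformity_sqDvd_of_davenport (hdict : threeTorsion_eq_two_mul_cubicFieldCountOfDisc_add_one)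
    (hcount : ∃ C : ℝ, ∀ s : ℤ, (s = 1 ∨ s = -1) → ∀ X : ℕ,
      (({O | ∃ f : BinaryCubic ℤ, O = gl2zOrbit f ∧ f.IsIrreducible ∧ 0 < s * f.disc ∧ s * f.disc < X}.ncard : ℕ) : ℝ)
        ≤ C * X) :
    btt_uniformity_sqDvd :=
  btt_uniformity_sqDvd_of_davenport_of_dictionary hdict hcount

end Literature.NumberTheory.CubicFields

end
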